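import Literature.AnabelianGeometry.EtaleTheta.Discharge.Sec3EffRealSpanTateTower
import Literature.AnabelianGeometry.EtaleTheta.Discharge.Sec3Cor38iiiKnitRankOnePointTateTower
import Literature.AnabelianGeometry.EtaleTheta.Discharge.Sec3Cor38iiSelfEquivalenceWeak
import Literature.AnabelianGeometry.EtaleTheta.Discharge.Sec3Prop34ConstOneComp
import HarnessLib

/-!
# [EtTh] Corollary 3.8 (i) ∧ (ii) ∧ (iii) at monoid type `Λ = ℝ`, AS TYPED, at the model of record and at the one-component model,
# with NO binder; the `Λ = ℝ` hull self-equivalence at rank-one points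

S. Mochizuki, *The étale theta function and its Frobenioid-theoretic manifestations*, Publ. RIMS **45** (2009), Cor. 3.8, PDF
pp. 80–81 [cite: MochizukiEtTh2009, Cor 3.8 p.80]; Def. 3.6 (i) p.76 (monoid type `Λ = ℝ`: `B₀^ℝ := ℝ·Φ₀^birat`,
`F₀^ℝ := ℝ·Φ₀^cnst`).

abc-iut cell, layer L2, seat abc-iut-L2-d2 (gen 5); ASSEMBLY sequel to `Sec3EffRealSpanTateTower.lean` (the `Λ = ℝ` effective-locus
clause `hE` PROVED at the Tate tower, `TateTowerFrd.effRealSpan_dm`, p461088) — the `Λ = ℝ` twin of `Sec3Cor38AllOfRankOnePoint.lean`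
(p451331, `Λ = ℤ`).  PROOF-ONLY:

* `TemperedFrobenioid.ofRankOnePointR_nonDilating`, `nonempty_cor38Hyp_ofRankOnePointR` — the Cor. 3.8 datum is INHABITED between
  two `Λ = ℝ` rank-one-point Frobenioids over the same data (`Ψ := 𝟭`; abc-iut-w6-d061's `isNonDilatingOn_ofRankOnePointR`);
* `TemperedFrobenioid.hull_selfEquivalence_ofRankOnePointR (hE)` — Cor. 3.8 (ii) for EVERY self-equivalence of a `Λ = ℝ`
  rank-one-point Frobenioid (abc-iut-L1-t12's `hull_selfEquivalence_weak_of_coord` with the `Λ = ℝ` inputs of p450744), residual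
  `hE` only; at the model of record `TateTowerFrd.hull_selfEquivalence_temperedFrobenioidR` with NO binder;
* **`TateTowerFrd.cor38_temperedFrobenioidR (h)`** — [EtTh] Cor. 3.8 (i) ∧ (ii) ∧ (iii) AS TYPED, `Λ = ℝ`, at the MODEL OF RECORD
  `TateTowerFrd.temperedFrobenioidR` (abc-iut-w6-d048) for EVERY Cor. 3.8 datum `h`, NO binder: (i)(ii) =
  `cor38_i_ii_temperedFrobenioidR_unconditional` (p461088), (iii) = abc-iut-w6-d052's `cor38_iii_tateTowerFrdR_unconditional`
  (p451056); conclusions `cor38_conclusion_temperedFrobenioidR`; ∃-form `exists_cor38Hyp_cor38_temperedFrobenioidR`;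
* **`OneCompFrd.cor38_temperedFrobenioidR (h)`** — the same at the ONE-COMPONENT model's `ℝ`-witness (abc-iut-w6-d048's
  `OneCompFrd.temperedFrobenioidR`; (i)(ii) = p450744's `OneCompFrd.cor38_i_ii_temperedFrobenioidR`, (iii) = abc-iut-w6-d052's
  `cor38_iii_ofRankOnePointR` with this seat's `OneCompFrd.prop34Const_dm`, p449874); ∃-form.

HONEST LABEL: instantiation / consistency certificates over the GENUINE weak vocabularies and CONSTRUCTED data; refereed pre-IUT
material; nothing here bears on [IUTchIII] Cor. 3.12; no side taken; typed ≠ proved — here proved, no binder left at these models.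
-/

noncomputable section

namespace Literature.AnabelianGeometry.EtaleTheta

open CategoryTheory Opposite Function Literature.AlgebraicGeometry.Frobenioids LogDivisorModel LogDivisorModel.GaloisAction

/-! ## §1 Rank-one points, monoid type `ℝ`: the datum is inhabited; the hull self-equivalence modulo `hE` -/

namespace TemperedFrobenioid

section RankOneR

variable {Z : LogDivisorModel.{0}} {G : Type} [Group G] {A : Z.GaloisAction G} (hZ : Z.CuspLaws) (P : RankOnePoint A)
  (hpf : ∀ Y : ((isConnectedGSet (G := G)).FullSubcategory)ᵒᵖ,
    IsPerfFactorialCof ((DivisorMonoids.ofGaloisActionConnected A hZ).Φ₀.obj Y))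
  (R S : ((Discrete PUnit.{1})ᵒᵖ ⥤ CommMonCat.{0}) → Prop)

/-- `Φ` of a `Λ = ℝ` rank-one-point Frobenioid is non-dilating under the endomorphisms of its one-point base (identities;
abc-iut-w6-d061's `isNonDilatingOn_ofRankOnePointR`, read through `isNonDilatingOn_divisorMonoid_iff`). [cite: MochizukiEtTh2009, Cor 3.8 p.80] -/
theorem ofRankOnePointR_nonDilating (B : (Discrete PUnit.{1})ᵒᵖ) (f : B ⟶ B) :
    treeMonoidVocabWeak.IsNonDilating _ ((ofRankOnePointR hZ P hpf R S).Φ.pull f) := by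
  rw [treeMonoidVocabWeak_isNonDilating]
  exact (ofRankOnePointR hZ P hpf R S).isNonDilatingOn_divisorMonoid_iff.mp (isNonDilatingOn_ofRankOnePointR hZ P hpf R S) B f

/-- **The Cor. 3.8 datum is inhabited between two `Λ = ℝ` rank-one-point Frobenioids over the SAME data** (`Ψ := 𝟭`; the
one-point base is of FSM-, hence FSMFF-type; `Φ` non-dilating). [cite: MochizukiEtTh2009, Cor 3.8 p.80] -/
theorem nonempty_cor38Hyp_ofRankOnePointR :
    Nonempty (Cor38Hyp (ofRankOnePointR hZ P hpf R S) (ofRankOnePointR hZ P hpf R S)) :=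
  ⟨{ Ψ := CategoryTheory.Equivalence.refl
     fsmff := ⟨PadicFrd.isOfFSMType_discretePUnit.isOfFSMFFType, PadicFrd.isOfFSMType_discretePUnit.isOfFSMFFType⟩
     nonDilating := ⟨ofRankOnePointR_nonDilating hZ P hpf R S, ofRankOnePointR_nonDilating hZ P hpf R S⟩ }⟩

/-- **[EtTh] Cor. 3.8 (ii) for EVERY self-equivalence `e` of a `Λ = ℝ` rank-one-point Frobenioid**, residual = the `Λ = ℝ`
effective-locus clause `hE` of the data only: `e` preserves the base-field-theoretic morphisms and lifts compatibly to a
self-equivalence of the real hull category — abc-iut-L1-t12's `hull_selfEquivalence_weak_of_coord` with the `Λ = ℝ` inputs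
`hP34Λ_ofGaloisActionConnected_weakR (hE)`, `exists_cnstFn_effective_ofRankOnePointR`, `hQ_ofRankOnePointR` (p450744) and
abc-iut-L6-t12's `ofRlfRWeak_hFinv'`. [cite: MochizukiEtTh2009, Cor 3.8 p.81] -/
theorem hull_selfEquivalence_ofRankOnePointR
    (hE : ∀ (Y : (isConnectedGSet (G := G)).FullSubcategory)
      (b : Algebra.GrothendieckGroup
        ((RealifiedDivisorMonoids.realDataWeak (DivisorMonoids.ofGaloisActionConnected A hZ) hpf).rlf.obj (op Y)))
      (x : (hpf (op Y)).weak.Rlf),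
      b ∈ ((RealifiedDivisorMonoids.realDataWeak (DivisorMonoids.ofGaloisActionConnected A hZ) hpf).realSpan
        (DivisorMonoids.ofGaloisActionConnected A hZ).biratGp).carrier Y →
      b = Algebra.GrothendieckGroup.of x →
      b ∈ ((RealifiedDivisorMonoids.realDataWeak (DivisorMonoids.ofGaloisActionConnected A hZ) hpf).realSpan
        (DivisorMonoids.ofGaloisActionConnected A hZ).cnstGp).carrier Y)
    (e : (ofRankOnePointR hZ P hpf R S).category ≌ (ofRankOnePointR hZ P hpf R S).category) :
    (∀ {X Y : (ofRankOnePointR hZ P hpf R S).category} (f : X ⟶ Y),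
        (ofRankOnePointR hZ P hpf R S).IsBaseFieldTheoretic f ↔
          (ofRankOnePointR hZ P hpf R S).IsBaseFieldTheoretic (e.functor.map f)) ∧
      ∃ e' : (ofRankOnePointR hZ P hpf R S).hullCategory ≌ (ofRankOnePointR hZ P hpf R S).hullCategory,
        Nonempty ((ofRankOnePointR hZ P hpf R S).hull ⋙ e.functor ≅ e'.functor ⋙ (ofRankOnePointR hZ P hpf R S).hull) :=
  (ofRankOnePointR hZ P hpf R S).hull_selfEquivalence_weak_of_coord PadicFrd.isOfFSMType_discretePUnit.isOfFSMFFType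
    (ofRankOnePointR_nonDilating hZ P hpf R S) (Toy.isDivSlim45iv_discretePUnit _)
    ((ofRankOnePointR hZ P hpf R S).isFrobenioid_of_isOfFSMType
      (RealifiedDivisorMonoids.ofRlfRWeak_hBinj_ofGaloisActionConnected A hZ hpf) PadicFrd.isOfFSMType_discretePUnit)
    (hP34Λ_ofGaloisActionConnected_weakR A hZ hpf hE) (exists_cnstFn_effective_ofRankOnePointR hZ P hpf R S)
    (hQ_ofRankOnePointR hZ P hpf R S) (RealifiedDivisorMonoids.ofRlfRWeak_hFinv' _ hpf) e

end RankOneR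

end TemperedFrobenioid

/-! ## §2 The model of record (the Tate tower), monoid type `Λ = ℝ`: NO binder -/

namespace TateTowerFrd

variable (R S R' S' : ((Discrete PUnit.{1})ᵒᵖ ⥤ CommMonCat.{0}) → Prop)

/-- **[EtTh] Cor. 3.8 (ii) for every self-equivalence of the `Λ = ℝ` model-of-record witness, NO binder** (`hE` = `effRealSpan_dm`).
[cite: MochizukiEtTh2009, Cor 3.8 p.81] -/
theorem hull_selfEquivalence_temperedFrobenioidR
    (e : (temperedFrobenioidR R S).category ≌ (temperedFrobenioidR R S).category) :
    (∀ {X Y : (temperedFrobenioidR R S).category} (f : X ⟶ Y),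
        (temperedFrobenioidR R S).IsBaseFieldTheoretic f ↔ (temperedFrobenioidR R S).IsBaseFieldTheoretic (e.functor.map f)) ∧
      ∃ e' : (temperedFrobenioidR R S).hullCategory ≌ (temperedFrobenioidR R S).hullCategory,
        Nonempty ((temperedFrobenioidR R S).hull ⋙ e.functor ≅ e'.functor ⋙ (temperedFrobenioidR R S).hull) :=
  TemperedFrobenioid.hull_selfEquivalence_ofRankOnePointR _ _ _ R S effRealSpan_dm e

/-- **[EtTh] Cor. 3.8 (i) ∧ (ii) ∧ (iii) AS TYPED, monoid type `Λ = ℝ`, at the MODEL OF RECORD, for every `h`, with NO binder beyond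
`h`** ((i)(ii) = `cor38_i_ii_temperedFrobenioidR_unconditional`, p461088; (iii) = abc-iut-w6-d052's
`LogDivisorModel.TateTower.cor38_iii_tateTowerFrdR_unconditional`, p451056). [cite: MochizukiEtTh2009, Cor 3.8 p.80] -/
theorem cor38_temperedFrobenioidR (h : Cor38Hyp (temperedFrobenioidR R S) (temperedFrobenioidR R' S')) :
    Literature.AnabelianGeometry.EtaleTheta.Cor38_i
        (fun E _ => Literature.AlgebraicGeometry.Frobenioids.IsFrobeniusSlim E) h ∧
      Literature.AnabelianGeometry.EtaleTheta.Cor38_ii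
        (fun E _ Φ => ∀ (B : E) (α : Aut (Over.forget B)),
          (∀ (B' : Over B) (x : Φ.obj (op B'.left)),
            Literature.AlgebraicGeometry.Frobenioids.pull Φ (α.hom.app B') x = x) → α = 1) h ∧
      Cor38_iii h :=
  ⟨(cor38_i_ii_temperedFrobenioidR_unconditional R S R' S' h).1, (cor38_i_ii_temperedFrobenioidR_unconditional R S R' S' h).2,
    LogDivisorModel.TateTower.cor38_iii_tateTowerFrdR_unconditional R S R' S' h⟩

/-- **The CONCLUSIONS of Cor. 3.8 (i), (ii) and the first clause of (iii), monoid type `Λ = ℝ`, at the model of record, for every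
`h`** (the one-object base is slim and Div-slim). [cite: MochizukiEtTh2009, Cor 3.8 p.81] -/
theorem cor38_conclusion_temperedFrobenioidR (h : Cor38Hyp (temperedFrobenioidR R S) (temperedFrobenioidR R' S')) :
    (PreservesBaseFieldTheoretic h ∧
      ∃ Ψbs : (temperedFrobenioidR R S).hullCategory ≌ (temperedFrobenioidR R' S').hullCategory,
        Nonempty ((temperedFrobenioidR R S).hull ⋙ h.Ψ.functor ≅ Ψbs.functor ⋙ (temperedFrobenioidR R' S').hull)) ∧
      Cor38_iii h :=
  ⟨cor38_i_ii_conclusion_temperedFrobenioidR_unconditional R S R' S' h,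
    LogDivisorModel.TateTower.cor38_iii_tateTowerFrdR_unconditional R S R' S' h⟩

/-- **The typed statements of the nodes `EtTh:Cor3.8(i)`, `(ii)`, `(iii)` at monoid type `Λ = ℝ` have a SIMULTANEOUS unconditional
kernel instance at the MODEL OF RECORD** (`Ψ := 𝟭`, `nonempty_cor38Hyp_ofRankOnePointR`). [cite: MochizukiEtTh2009, Cor 3.8 p.80] -/
theorem exists_cor38Hyp_cor38_temperedFrobenioidR :
    ∃ h : Cor38Hyp (temperedFrobenioidR R S) (temperedFrobenioidR R S),
      Literature.AnabelianGeometry.EtaleTheta.Cor38_i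
          (fun E _ => Literature.AlgebraicGeometry.Frobenioids.IsFrobeniusSlim E) h ∧
        Literature.AnabelianGeometry.EtaleTheta.Cor38_ii
          (fun E _ Φ => ∀ (B : E) (α : Aut (Over.forget B)),
            (∀ (B' : Over B) (x : Φ.obj (op B'.left)),
              Literature.AlgebraicGeometry.Frobenioids.pull Φ (α.hom.app B') x = x) → α = 1) h ∧
        Cor38_iii h := by
  obtain ⟨h⟩ := TemperedFrobenioid.nonempty_cor38Hyp_ofRankOnePointR TateTower.cuspLaws rankOnePoint hpf R S
  exact ⟨h, cor38_temperedFrobenioidR R S R S h⟩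

end TateTowerFrd

/-! ## §3 The one-component model, monoid type `Λ = ℝ`: NO binder -/

namespace OneCompFrd

variable (U : Type) [CommGroup U] (hU : ∀ u : U, (∀ N : ℕ+, ∃ g : U, g ^ (N : ℕ) = u) → u = 1)
  (R S R' S' : ((Discrete PUnit.{1})ᵒᵖ ⥤ CommMonCat.{0}) → Prop)

/-- **[EtTh] Cor. 3.8 (i) ∧ (ii) ∧ (iii) AS TYPED, monoid type `Λ = ℝ`, at the ONE-COMPONENT model's `ℝ`-witness, for every `h`, NO
binder** ((i)(ii) = p450744's `OneCompFrd.cor38_i_ii_temperedFrobenioidR`; (iii) = abc-iut-w6-d052's `cor38_iii_ofRankOnePointR` with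
`OneCompFrd.prop34Const_dm`, p449874, and the countability of the model's data). [cite: MochizukiEtTh2009, Cor 3.8 p.80] -/
theorem cor38_temperedFrobenioidR (h : Cor38Hyp (temperedFrobenioidR U hU R S) (temperedFrobenioidR U hU R' S')) :
    Literature.AnabelianGeometry.EtaleTheta.Cor38_i
        (fun E _ => Literature.AlgebraicGeometry.Frobenioids.IsFrobeniusSlim E) h ∧
      Literature.AnabelianGeometry.EtaleTheta.Cor38_ii
        (fun E _ Φ => ∀ (B : E) (α : Aut (Over.forget B)),
          (∀ (B' : Over B) (x : Φ.obj (op B'.left)),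
            Literature.AlgebraicGeometry.Frobenioids.pull Φ (α.hom.app B') x = x) → α = 1) h ∧
      Cor38_iii h := by
  haveI : Countable (oneComp U hU).Cusp := show Countable PEmpty.{1} from inferInstance
  haveI : Countable (oneComp U hU).Comp := show Countable PUnit.{1} from inferInstance
  exact ⟨(cor38_i_ii_temperedFrobenioidR U hU R S R' S' h).1, (cor38_i_ii_temperedFrobenioidR U hU R S R' S' h).2,
    TemperedFrobenioid.cor38_iii_ofRankOnePointR _ _ _ R S _ _ _ R' S' h (prop34Const_dm U hU) (prop34Const_dm U hU)⟩

/-- **The typed statements of the nodes `EtTh:Cor3.8(i)`, `(ii)`, `(iii)` at `Λ = ℝ` have a SIMULTANEOUS unconditional kernel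
instance at the one-component model** (`Ψ := 𝟭`). [cite: MochizukiEtTh2009, Cor 3.8 p.80] -/
theorem exists_cor38Hyp_cor38_temperedFrobenioidR :
    ∃ h : Cor38Hyp (temperedFrobenioidR U hU R S) (temperedFrobenioidR U hU R S),
      Literature.AnabelianGeometry.EtaleTheta.Cor38_i
          (fun E _ => Literature.AlgebraicGeometry.Frobenioids.IsFrobeniusSlim E) h ∧
        Literature.AnabelianGeometry.EtaleTheta.Cor38_ii
          (fun E _ Φ => ∀ (B : E) (α : Aut (Over.forget B)),
            (∀ (B' : Over B) (x : Φ.obj (op B'.left)),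
              Literature.AlgebraicGeometry.Frobenioids.pull Φ (α.hom.app B') x = x) → α = 1) h ∧
        Cor38_iii h := by
  obtain ⟨h⟩ := TemperedFrobenioid.nonempty_cor38Hyp_ofRankOnePointR (cuspLaws_oneComp U hU) (rankOnePoint U hU)
    (hpfCof_oneComp U hU) R S
  exact ⟨h, cor38_temperedFrobenioidR U hU R S R S h⟩

end OneCompFrd

end Literature.AnabelianGeometry.EtaleTheta

end
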